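import Summits.AtomisticToContinuum.FouriersLaw.Theses.BondHeatUncertainty

/-!
# `SubdiffusiveBondHeat` / Negative: the Thouless window is exactly the transfer threshold

Negative-side support for crux `stmt-AtomisticToContinuum-9120`
(`BondHeatUncertainty.SubdiffusiveBondHeat` (S): `V_N(b,t) ≤ A√t` on the window `[1, cN²]`), from the standing
disprover's work file `Cruxes/SubdiffusiveBondHeat/Disproof.lean` §1, §3 (generation 1, 2026-08-16); all sorry-free,
real arithmetic only.  Question answered: can the window of (S) be moved?

* `transfer_fails_below_thouless` — NO SMALLER WINDOW SERVES THE ROUTE.  The transfer behind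
  `TransferToBoundedResponse` ((S) ∧ (K) `K_N ≤ CN` ∧ (★) `2G_N²t² ≤ V_N(b,t)(G_N t/T² + K_N)` ⇒ `N·G_N` bounded),
  abstracted over its data with window `[1, cN^α]`, FAILS for every `α < 2`: the saturating model
  `G_N = N^{1/2−3α/4}`, `K_N = N`, `V_N(t) = 2G_N²t²/(G_N t + K_N)` ((★) an equality) obeys the window law with
  `A = 2`, `c = 1` and has `N·G_N = N^{3(2−α)/4} → ∞`.  In particular light-cone data (`α = 1`,
  `LightConeBondHeat`) give at best `G_N = O(N^{-1/4})` through (★)+(K) — the exponent of `TransferToNonBallistic`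
  is optimal for the method — and never bounded response.
* `transfer_of_two_le` — from the Thouless exponent on (`2 ≤ α`) the abstract transfer holds (the route's
  arithmetic at `t = cN²`), so `α = 2` is EXACTLY the threshold.
* `not_window_cube_of_ohmicFloor` — NO LARGER WINDOW CAN BE TRUE under Fourier's law: an Ohmic floor
  `V_N(b,t) ≥ g·t/N` for `t ≥ N²` (Kubo–KDN saturation `V_N ∼ 2T²G_N t` with `G_N ≳ κ/N`) refutes the window law
  with window `cN³`.
* `window_of_diffusive_ohmic`, `subdiffusiveBondHeat_of_diffusive_ohmic` — the expected physical shape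
  `V_N(b_N,t) ≤ a√t + B·t/N` (`t ≥ 1`) gives (S) for EVERY `c > 0` with `A = a + B√c`: the crossover at the Thouless
  time is harmless; all difficulty of (S) is in the two N-uniform constants `a` (EW spreading) and `B` (Ohmic
  conductance), none in the window.
Nothing here closes an item.
-/

noncomputable section

open MeasureTheory Filter Topology Set
open Literature.MathematicalPhysics.KineticTheory.HeatConduction

namespace Summit.AtomisticToContinuum.FouriersLaw.Theorems.SubdiffusiveBondHeat.Negative.WindowThreshold

open Summit.AtomisticToContinuum.FouriersLaw.Theses.BondHeatUncertainty (SubdiffusiveBondHeat)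

/-- **Below the Thouless exponent the transfer fails** (explicit saturating counter-model, temperature normalised to
`T = 1`): for `α < 2` there are nonnegative data `V, G, K` with `K_N ≤ N`, the window law `V_N(t) ≤ 2√t` on
`[1, N^α]` (`N ≥ 1`), the uncertainty inequality (★) for all `t > 0`, and `N·G_N = N^{3(2−α)/4}` unbounded.
[folklore] -/
theorem transfer_fails_below_thouless {α : ℝ} (hα : α < 2) :
    ∃ (V : ℕ → ℝ → ℝ) (G K : ℕ → ℝ),
      (∀ N, 0 ≤ G N) ∧ (∀ N, 0 ≤ K N) ∧ (∀ N : ℕ, K N ≤ 1 * N) ∧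
      (∀ N : ℕ, 1 ≤ N → ∀ t : ℝ, 1 ≤ t → t ≤ 1 * (N : ℝ) ^ α → V N t ≤ 2 * Real.sqrt t) ∧
      (∀ N : ℕ, ∀ t : ℝ, 0 < t → 2 * G N ^ 2 * t ^ 2 ≤ V N t * (G N * t + K N)) ∧
      (∀ N : ℕ, N ≠ 0 → (N : ℝ) * G N = (N : ℝ) ^ (3 * (2 - α) / 4)) ∧
      ¬ BddAbove (Set.range fun N : ℕ => (N : ℝ) * G N) := by
  -- the model
  set w : ℕ → ℝ := fun N => (N : ℝ) ^ (α / 4) with hw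
  set G : ℕ → ℝ := fun N => if N = 0 then 0 else Real.sqrt N / w N ^ 3 with hG
  set K : ℕ → ℝ := fun N => (N : ℝ) with hK
  set V : ℕ → ℝ → ℝ := fun N t => if N = 0 then 0 else 2 * G N ^ 2 * t ^ 2 / (G N * t + K N) with hV
  have hwpos : ∀ N : ℕ, N ≠ 0 → 0 < w N := fun N hN => by
    have : (0 : ℝ) < N := by exact_mod_cast Nat.pos_of_ne_zero hN
    exact Real.rpow_pos_of_pos this _
  have hGnn : ∀ N, 0 ≤ G N := fun N => by
    by_cases hN : N = 0
    · simp [hG, hN]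
    · simp only [hG, hN, if_false]
      exact div_nonneg (Real.sqrt_nonneg _) (pow_nonneg (hwpos N hN).le 3)
  have hGpos : ∀ N : ℕ, N ≠ 0 → 0 < G N := fun N hN => by
    simp only [hG, hN, if_false]
    have : (0 : ℝ) < N := by exact_mod_cast Nat.pos_of_ne_zero hN
    exact div_pos (Real.sqrt_pos.2 this) (pow_pos (hwpos N hN) 3)
  have hKnn : ∀ N, 0 ≤ K N := fun N => by simp [hK]
  have hKle : ∃ C : ℝ, ∀ N : ℕ, K N ≤ C * N := ⟨1, fun N => by simp [hK]⟩
  have hden : ∀ N : ℕ, N ≠ 0 → ∀ t : ℝ, 0 ≤ t → 0 < G N * t + K N := fun N hN t ht => by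
    have : (0 : ℝ) < N := by exact_mod_cast Nat.pos_of_ne_zero hN
    have h1 : 0 ≤ G N * t := mul_nonneg (hGnn N) ht
    simp only [hK]; linarith
  -- (★) holds (with equality for N ≠ 0)
  have hstar : ∀ N : ℕ, ∀ t : ℝ, 0 < t → 2 * G N ^ 2 * t ^ 2 ≤ V N t * (G N * t + K N) := by
    intro N t ht
    by_cases hN : N = 0
    · simp [hV, hG, hN]
    · simp only [hV, hN, if_false]
      rw [div_mul_cancel₀ _ (hden N hN t ht.le).ne']
  -- the window law with A = 2, c = 1, N₀ = 1
  have hwin : ∀ N : ℕ, 1 ≤ N → ∀ t : ℝ, 1 ≤ t → t ≤ 1 * (N : ℝ) ^ α → V N t ≤ 2 * Real.sqrt t := by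
    intro N hN t ht htw
    have hN0 : N ≠ 0 := by omega
    have hNpos : (0 : ℝ) < N := by exact_mod_cast Nat.pos_of_ne_zero hN0
    have ht0 : 0 < t := by linarith
    simp only [hV, hN0, if_false]
    -- V ≤ 2 G² t² / K
    have hKpos : 0 < K N := by simp only [hK]; exact hNpos
    have h1 : 2 * G N ^ 2 * t ^ 2 / (G N * t + K N) ≤ 2 * G N ^ 2 * t ^ 2 / K N := by
      apply div_le_div_of_nonneg_left (by positivity) hKpos
      have := mul_nonneg (hGnn N) ht0.le
      linarith
    -- 2 G² t² / K = 2 t² / w⁶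
    have hG2 : G N ^ 2 = (N : ℝ) / w N ^ 6 := by
      simp only [hG, hN0, if_false]
      rw [div_pow, Real.sq_sqrt hNpos.le]; ring
    have hw6 : 0 < w N ^ 6 := pow_pos (hwpos N hN0) 6
    have h2 : 2 * G N ^ 2 * t ^ 2 / K N = 2 * t ^ 2 / w N ^ 6 := by
      rw [hG2]; simp only [hK]; field_simp
    -- window: t ≤ N^α = (w N)^4, hence √t ≤ (w N)^2 and t² ≤ √t · w⁶
    have hw4 : (N : ℝ) ^ α = w N ^ 4 := by
      simp only [hw]; rw [← Real.rpow_natCast, ← Real.rpow_mul hNpos.le]; norm_num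
    rw [one_mul, hw4] at htw
    have hst : Real.sqrt t ≤ w N ^ 2 := by
      have : Real.sqrt (w N ^ 4) = w N ^ 2 := by
        rw [show w N ^ 4 = (w N ^ 2) ^ 2 by ring, Real.sqrt_sq (by positivity)]
      rw [← this]; exact Real.sqrt_le_sqrt htw
    have hs0 : 0 ≤ Real.sqrt t := Real.sqrt_nonneg t
    have ht2 : t ^ 2 ≤ Real.sqrt t * w N ^ 6 := by
      have e : t ^ 2 = Real.sqrt t * Real.sqrt t ^ 3 := by
        have := Real.mul_self_sqrt ht0.le
        calc t ^ 2 = (Real.sqrt t * Real.sqrt t) ^ 2 := by rw [this]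
          _ = Real.sqrt t * Real.sqrt t ^ 3 := by ring
      rw [e]
      have : Real.sqrt t ^ 3 ≤ (w N ^ 2) ^ 3 := pow_le_pow_left₀ hs0 hst 3
      calc Real.sqrt t * Real.sqrt t ^ 3 ≤ Real.sqrt t * (w N ^ 2) ^ 3 :=
            mul_le_mul_of_nonneg_left this hs0
        _ = Real.sqrt t * w N ^ 6 := by ring
    calc 2 * G N ^ 2 * t ^ 2 / (G N * t + K N) ≤ 2 * G N ^ 2 * t ^ 2 / K N := h1
      _ = 2 * t ^ 2 / w N ^ 6 := h2
      _ ≤ 2 * (Real.sqrt t * w N ^ 6) / w N ^ 6 := by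
          apply div_le_div_of_nonneg_right _ hw6.le; linarith
      _ = 2 * Real.sqrt t := by rw [mul_div_assoc, mul_div_cancel_right₀ _ hw6.ne']
  have hNG : ∀ N : ℕ, N ≠ 0 → (N : ℝ) * G N = (N : ℝ) ^ (3 * (2 - α) / 4) := by
    intro N hN0
    have hNpos : (0 : ℝ) < N := by exact_mod_cast Nat.pos_of_ne_zero hN0
    simp only [hG, hN0, if_false, hw]
    rw [Real.sqrt_eq_rpow, ← Real.rpow_natCast, ← Real.rpow_mul hNpos.le, mul_div_assoc']
    rw [show (N : ℝ) * (N : ℝ) ^ (1 / 2 : ℝ) = (N : ℝ) ^ (1 : ℝ) * (N : ℝ) ^ (1 / 2 : ℝ) by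
      rw [Real.rpow_one], ← Real.rpow_add hNpos, ← Real.rpow_sub hNpos]
    congr 1
    push_cast
    ring
  have hexp : 0 < 3 * (2 - α) / 4 := by linarith
  have htend : Filter.Tendsto (fun N : ℕ => (N : ℝ) ^ (3 * (2 - α) / 4)) Filter.atTop Filter.atTop :=
    (tendsto_rpow_atTop hexp).comp tendsto_natCast_atTop_atTop
  have hunb : ¬ BddAbove (Set.range fun N : ℕ => (N : ℝ) * G N) := by
    rintro ⟨B, hB⟩
    obtain ⟨N, hN⟩ := Filter.eventually_atTop.mp (htend.eventually_gt_atTop B)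
    have hN1 : max N 1 ≠ 0 := by omega
    have h1 := hN (max N 1) (le_max_left _ _)
    have h2 : (max N 1 : ℕ) * G (max N 1) ≤ B := hB ⟨max N 1, rfl⟩
    rw [hNG _ hN1] at h2
    linarith
  exact ⟨V, G, K, hGnn, hKnn, fun N => by simp [hK], hwin, hstar, hNG, hunb⟩


/-- **From the Thouless exponent on, the transfer holds** (the route's `TransferToBoundedResponse` arithmetic,
abstractly; temperature normalised to `T = 1`): nonnegative data with `K_N ≤ CN`, the window law on `[1, cN^α]`
with `2 ≤ α`, and (★) for all `t > 0` force `N·G_N` bounded — evaluate (★) at `t = cN²`, where `V ≤ A√c·N`, to get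
`2c²x² ≤ (A√c·c)x + A√c·C` for `x = N·G_N`.  Together with `transfer_fails_below_thouless`: the Thouless exponent
`2` is EXACTLY the threshold of the method. [folklore] -/
theorem transfer_of_two_le {α : ℝ} (hα : 2 ≤ α) (V : ℕ → ℝ → ℝ) (G K : ℕ → ℝ)
    (hG : ∀ N, 0 ≤ G N) (hK : ∀ N, 0 ≤ K N) (hKC : ∃ C : ℝ, ∀ N : ℕ, K N ≤ C * N)
    (hwin : ∃ A c : ℝ, 0 < c ∧ ∃ N₀ : ℕ, ∀ N : ℕ, N₀ ≤ N → ∀ t : ℝ, 1 ≤ t → t ≤ c * (N : ℝ) ^ α →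
        V N t ≤ A * Real.sqrt t)
    (hstar : ∀ N : ℕ, ∀ t : ℝ, 0 < t → 2 * G N ^ 2 * t ^ 2 ≤ V N t * (G N * t + K N)) :
    BddAbove (Set.range fun N : ℕ => (N : ℝ) * G N) := by
  obtain ⟨C, hC⟩ := hKC
  obtain ⟨A, c, hc, N₀, hwin⟩ := hwin
  set A' : ℝ := max A 0 with hA'
  set C' : ℝ := max C 0 with hC'
  have hA'0 : 0 ≤ A' := le_max_right _ _
  have hC'0 : 0 ≤ C' := le_max_right _ _
  set P : ℝ := A' * Real.sqrt c * c with hP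
  set Q : ℝ := A' * Real.sqrt c * C' with hQ
  have hP0 : 0 ≤ P := by positivity
  have hQ0 : 0 ≤ Q := by positivity
  set B : ℝ := max 1 ((P + Q) / (2 * c ^ 2)) with hB
  set N₁ : ℕ := ⌈1 / c⌉₊ + 1 with hN₁
  set M : ℕ := max N₀ N₁ with hM
  -- the tail bound
  have key : ∀ N : ℕ, M ≤ N → (N : ℝ) * G N ≤ B := by
    intro N hMN
    have hN0N : N₀ ≤ N := le_trans (le_max_left _ _) hMN
    have hN1N : N₁ ≤ N := le_trans (le_max_right _ _) hMN
    have hNge1 : (1 : ℝ) ≤ N := by exact_mod_cast (show 1 ≤ N by omega)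
    have hNpos : (0 : ℝ) < N := by linarith
    have hNc : 1 / c ≤ (N : ℝ) := by
      have h1 : (1 / c : ℝ) ≤ ⌈1 / c⌉₊ := Nat.le_ceil _
      have h2 : ((⌈1 / c⌉₊ : ℕ) : ℝ) + 1 ≤ N := by exact_mod_cast hN1N
      linarith
    -- t := c N²
    set t : ℝ := c * (N : ℝ) ^ 2 with ht
    have ht1 : 1 ≤ t := by
      have : 1 ≤ c * (N : ℝ) := by
        rw [div_le_iff₀ hc] at hNc; linarith
      have hN2 : (N : ℝ) ≤ (N : ℝ) ^ 2 := by nlinarith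
      calc (1 : ℝ) ≤ c * N := this
        _ ≤ c * (N : ℝ) ^ 2 := mul_le_mul_of_nonneg_left hN2 hc.le
    have ht0 : 0 < t := by linarith
    have htw : t ≤ c * (N : ℝ) ^ α := by
      apply mul_le_mul_of_nonneg_left _ hc.le
      rw [show (N : ℝ) ^ 2 = (N : ℝ) ^ ((2 : ℕ) : ℝ) by rw [Real.rpow_natCast]]
      exact Real.rpow_le_rpow_of_exponent_le hNge1 (by exact_mod_cast hα)
    have hsqrt : Real.sqrt t = Real.sqrt c * N := by
      rw [ht, Real.sqrt_mul hc.le, Real.sqrt_sq hNpos.le]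
    -- V ≤ A' √c N
    have hV : V N t ≤ A' * Real.sqrt c * N := by
      calc V N t ≤ A * Real.sqrt t := hwin N hN0N t ht1 htw
        _ ≤ A' * Real.sqrt t := mul_le_mul_of_nonneg_right (le_max_left _ _) (Real.sqrt_nonneg _)
        _ = A' * Real.sqrt c * N := by rw [hsqrt]; ring
    -- K ≤ C' N
    have hKN : K N ≤ C' * N :=
      (hC N).trans (mul_le_mul_of_nonneg_right (le_max_left _ _) hNpos.le)
    have hfac : 0 ≤ G N * t + K N := by
      have := mul_nonneg (hG N) ht0.le; have := hK N; linarith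
    -- (★) at t
    have h1 : 2 * G N ^ 2 * t ^ 2 ≤ A' * Real.sqrt c * N * (G N * t + C' * N) := by
      calc 2 * G N ^ 2 * t ^ 2 ≤ V N t * (G N * t + K N) := hstar N t ht0
        _ ≤ (A' * Real.sqrt c * N) * (G N * t + K N) := mul_le_mul_of_nonneg_right hV hfac
        _ ≤ (A' * Real.sqrt c * N) * (G N * t + C' * N) := by
            apply mul_le_mul_of_nonneg_left _ (by positivity); linarith
    -- in terms of x = N G: 2 c² x² ≤ P x + Q
    set x : ℝ := (N : ℝ) * G N with hx
    have hx0 : 0 ≤ x := mul_nonneg hNpos.le (hG N)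
    have h2 : 2 * c ^ 2 * x ^ 2 * (N : ℝ) ^ 2 ≤ (P * x + Q) * (N : ℝ) ^ 2 := by
      have e1 : 2 * G N ^ 2 * t ^ 2 = 2 * c ^ 2 * x ^ 2 * (N : ℝ) ^ 2 := by
        simp only [ht, hx]; ring
      have e2 : A' * Real.sqrt c * N * (G N * t + C' * N) = (P * x + Q) * (N : ℝ) ^ 2 := by
        simp only [ht, hx, hP, hQ]; ring
      rw [← e1, ← e2]; exact h1
    have hN2pos : (0 : ℝ) < (N : ℝ) ^ 2 := by positivity
    have h3 : 2 * c ^ 2 * x ^ 2 ≤ P * x + Q := le_of_mul_le_mul_right h2 hN2pos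
    -- conclude x ≤ B
    by_cases hx1 : x ≤ 1
    · exact hx1.trans (le_max_left _ _)
    · push Not at hx1
      have hc2 : 0 < 2 * c ^ 2 := by positivity
      have h4 : 2 * c ^ 2 * x ≤ P + Q := by
        -- from 2c²x² ≤ Px + Q and x > 1: 2c²x·x ≤ P x + Q ≤ P x + Q x
        have hQx : Q ≤ Q * x := le_mul_of_one_le_right hQ0 hx1.le
        have h5 : 2 * c ^ 2 * x * x ≤ (P + Q) * x := by nlinarith
        exact le_of_mul_le_mul_right h5 (by linarith)
      have h6 : x ≤ (P + Q) / (2 * c ^ 2) := by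
        rw [le_div_iff₀ hc2]; linarith
      exact h6.trans (le_max_right _ _)
  -- assemble a global bound
  refine ⟨B + ∑ k ∈ Finset.range M, (k : ℝ) * G k, ?_⟩
  rintro y ⟨N, rfl⟩
  have hsum0 : 0 ≤ ∑ k ∈ Finset.range M, (k : ℝ) * G k :=
    Finset.sum_nonneg fun k _ => mul_nonneg (Nat.cast_nonneg k) (hG k)
  have hB1 : (1 : ℝ) ≤ B := le_max_left _ _
  by_cases hMN : M ≤ N
  · have := key N hMN
    show (N : ℝ) * G N ≤ B + _
    linarith
  · push Not at hMN
    have hmem : N ∈ Finset.range M := Finset.mem_range.2 hMN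
    have hle : (N : ℝ) * G N ≤ ∑ k ∈ Finset.range M, (k : ℝ) * G k :=
      Finset.single_le_sum (f := fun k : ℕ => (k : ℝ) * G k)
        (fun k _ => mul_nonneg (Nat.cast_nonneg k) (hG k)) hmem
    show (N : ℝ) * G N ≤ B + _
    linarith


/-- **Converse tightness: under an Ohmic floor the Thouless exponent is maximal.**  If the bond-heat variance has
an Ohmic floor `V_N(b,t) ≥ g·t/N` for `t ≥ N²` at every admissible bond (`g > 0`; this is the Kubo–KDN saturation
`V_N ∼ 2T²G_N t` together with a conductance LOWER bound `G_N ≥ g/(2T²N)`, i.e. the positive half of Fourier's law,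
cf. `PositiveOrInfiniteLimit` / `ConductanceLowerBound` on the ledger), then the window law with window `c·N³`
fails (likewise for any window `c·N^k`, `k > 2`).  So (S) cannot be strengthened in the window if Fourier's law is
true, and cannot be weakened in the window if it is to serve the route (`transfer_fails_below_thouless`).
[folklore] -/
theorem not_window_cube_of_ohmicFloor (V : ℕ → ℕ → ℝ → ℝ) {g : ℝ} (hg : 0 < g)
    (hfloor : ∃ N₁ : ℕ, ∀ N : ℕ, N₁ ≤ N → ∀ b : ℕ, b + 1 < N → ∀ t : ℝ, (N : ℝ) ^ 2 ≤ t →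
      g * t / N ≤ V N b t) :
    ¬ ∃ A c : ℝ, 0 < c ∧ ∃ N₀ : ℕ, ∀ N : ℕ, N₀ ≤ N → ∃ b : ℕ, b + 1 < N ∧
        ∀ t : ℝ, 1 ≤ t → t ≤ c * (N : ℝ) ^ 3 → V N b t ≤ A * Real.sqrt t := by
  rintro ⟨A, c, hc, N₀, hwin⟩
  obtain ⟨N₁, hfloor⟩ := hfloor
  -- R := (A √c / (g c))², pick N > max's
  set R : ℝ := (max A 0 * Real.sqrt c / (g * c)) ^ 2 with hR
  set N : ℕ := max (max N₀ N₁) (max (⌈1 / c⌉₊ + 1) (⌈R⌉₊ + 1)) with hNdef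
  have hN0 : N₀ ≤ N := le_trans (le_max_left _ _) (le_max_left _ _)
  have hN1 : N₁ ≤ N := le_trans (le_max_right _ _) (le_max_left _ _)
  have hNc' : ⌈1 / c⌉₊ + 1 ≤ N := le_trans (le_max_left _ _) (le_max_right _ _)
  have hNR' : ⌈R⌉₊ + 1 ≤ N := le_trans (le_max_right _ _) (le_max_right _ _)
  have hNpos : (0 : ℝ) < N := by exact_mod_cast (show 0 < N by omega)
  have hNc : 1 ≤ c * (N : ℝ) := by
    have h1 : (1 / c : ℝ) ≤ ⌈1 / c⌉₊ := Nat.le_ceil _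
    have h2 : ((⌈1 / c⌉₊ : ℕ) : ℝ) + 1 ≤ N := by exact_mod_cast hNc'
    rw [div_le_iff₀ hc] at h1
    nlinarith
  have hNR : R < N := by
    have h1 : R ≤ ⌈R⌉₊ := Nat.le_ceil _
    have h2 : ((⌈R⌉₊ : ℕ) : ℝ) + 1 ≤ N := by exact_mod_cast hNR'
    linarith
  obtain ⟨b, hb, hwin⟩ := hwin N hN0
  set t : ℝ := c * (N : ℝ) ^ 3 with ht
  have hN2t : (N : ℝ) ^ 2 ≤ t := by
    have : (N : ℝ) ^ 2 * 1 ≤ (N : ℝ) ^ 2 * (c * N) := mul_le_mul_of_nonneg_left hNc (by positivity)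
    calc (N : ℝ) ^ 2 = (N : ℝ) ^ 2 * 1 := by ring
      _ ≤ (N : ℝ) ^ 2 * (c * N) := this
      _ = t := by rw [ht]; ring
  have hNge1 : (1 : ℝ) ≤ N := by exact_mod_cast (show 1 ≤ N by omega)
  have ht1 : 1 ≤ t := le_trans (by nlinarith) hN2t
  have hup : V N b t ≤ A * Real.sqrt t := hwin t ht1 le_rfl
  have hlow : g * t / N ≤ V N b t := hfloor N hN1 b hb t hN2t
  -- √t = √c · N · √N
  have hsqrt : Real.sqrt t = Real.sqrt c * N * Real.sqrt N := by
    rw [ht, show c * (N : ℝ) ^ 3 = c * ((N : ℝ) ^ 2 * N) by ring, Real.sqrt_mul hc.le,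
      Real.sqrt_mul (by positivity), Real.sqrt_sq hNpos.le]; ring
  have hgt : g * t / N = g * c * (N : ℝ) ^ 2 := by
    rw [ht, div_eq_iff hNpos.ne']; ring
  -- g c N² ≤ A' √c N √N  ⇒ √N ≤ A' √c /(g c) ⇒ N ≤ R
  have hA' : A * Real.sqrt t ≤ max A 0 * Real.sqrt t :=
    mul_le_mul_of_nonneg_right (le_max_left _ _) (Real.sqrt_nonneg _)
  have hmain : g * c * (N : ℝ) ^ 2 ≤ max A 0 * Real.sqrt c * N * Real.sqrt N := by
    have := (hlow.trans hup).trans hA'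
    rw [hgt, hsqrt] at this; linarith
  have hsN : Real.sqrt (N : ℝ) ≤ max A 0 * Real.sqrt c / (g * c) := by
    rw [le_div_iff₀ (by positivity)]
    have hNs : (N : ℝ) = Real.sqrt N * Real.sqrt N := (Real.mul_self_sqrt hNpos.le).symm
    have h3 : g * c * (Real.sqrt N * Real.sqrt N) * N ≤ max A 0 * Real.sqrt c * Real.sqrt N * N := by
      calc g * c * (Real.sqrt N * Real.sqrt N) * N = g * c * (N : ℝ) ^ 2 := by rw [← hNs]; ring
        _ ≤ max A 0 * Real.sqrt c * N * Real.sqrt N := hmain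
        _ = max A 0 * Real.sqrt c * Real.sqrt N * N := by ring
    have h4 : g * c * (Real.sqrt N * Real.sqrt N) ≤ max A 0 * Real.sqrt c * Real.sqrt N :=
      le_of_mul_le_mul_right h3 hNpos
    have hspos : 0 < Real.sqrt (N : ℝ) := Real.sqrt_pos.2 hNpos
    have h5 : g * c * Real.sqrt N * Real.sqrt N ≤ max A 0 * Real.sqrt c * Real.sqrt N := by linarith [h4]
    have := le_of_mul_le_mul_right h5 hspos
    linarith
  have hNle : (N : ℝ) ≤ R := by
    have h0 : 0 ≤ Real.sqrt (N : ℝ) := Real.sqrt_nonneg _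
    calc (N : ℝ) = Real.sqrt N ^ 2 := by rw [Real.sq_sqrt hNpos.le]
      _ ≤ (max A 0 * Real.sqrt c / (g * c)) ^ 2 := pow_le_pow_left₀ h0 hsN 2
      _ = R := by rw [hR]
  linarith

/-- SHAPE LEMMA (prover information).  The physically expected form of the bond-heat variance of a diffusive open
chain — EW law plus Kubo–KDN saturation, `V_N(b_N,t) ≤ a√t + B·t/N` for `t ≥ 1` (`B ≈ 2T²·N G_N ≈ 2T²κ`) — gives the
Thouless-window law for EVERY `c > 0`, with `A = a + B√c`.  Hence the crossover at `t ≍ N²` is harmless and the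
window is not where (S) can fail; all difficulty is in the two N-uniform inputs `a` (diffusive spreading) and `B`
(Ohmic conductance). [folklore] -/
theorem window_of_diffusive_ohmic (V : ℕ → ℕ → ℝ → ℝ) (b : ℕ → ℕ) (a B : ℝ) (hB : 0 ≤ B) (N₁ : ℕ)
    (hb : ∀ N : ℕ, N₁ ≤ N → b N + 1 < N)
    (hV : ∀ N : ℕ, N₁ ≤ N → ∀ t : ℝ, 1 ≤ t → V N (b N) t ≤ a * Real.sqrt t + B * t / N) :
    ∀ c : ℝ, 0 < c → ∃ N₀ : ℕ, ∀ N : ℕ, N₀ ≤ N → ∃ b' : ℕ, b' + 1 < N ∧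
      ∀ t : ℝ, 1 ≤ t → t ≤ c * (N : ℝ) ^ 2 → V N b' t ≤ (a + B * Real.sqrt c) * Real.sqrt t := by
  intro c hc
  refine ⟨max N₁ 1, fun N hN => ⟨b N, hb N (le_trans (le_max_left _ _) hN), fun t ht htc => ?_⟩⟩
  have hN1 : N₁ ≤ N := le_trans (le_max_left _ _) hN
  have hN' : (0 : ℝ) < N := by exact_mod_cast (lt_of_lt_of_le Nat.one_pos (le_trans (le_max_right _ _) hN))
  have ht0 : 0 ≤ t := by linarith
  have hst : Real.sqrt t * Real.sqrt t = t := Real.mul_self_sqrt ht0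
  have h1 : Real.sqrt t ≤ Real.sqrt c * N := by
    rw [show Real.sqrt c * N = Real.sqrt (c * (N : ℝ) ^ 2) by
      rw [Real.sqrt_mul hc.le, Real.sqrt_sq hN'.le]]
    exact Real.sqrt_le_sqrt htc
  have h2 : B * t / N ≤ B * Real.sqrt c * Real.sqrt t := by
    rw [div_le_iff₀ hN']
    calc B * t = B * (Real.sqrt t * Real.sqrt t) := by rw [hst]
      _ ≤ B * (Real.sqrt t * (Real.sqrt c * N)) := by
          apply mul_le_mul_of_nonneg_left _ hB
          exact mul_le_mul_of_nonneg_left h1 (Real.sqrt_nonneg _)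
      _ = B * Real.sqrt c * Real.sqrt t * N := by ring
  calc V N (b N) t ≤ a * Real.sqrt t + B * t / N := hV N hN1 t ht
    _ ≤ a * Real.sqrt t + B * Real.sqrt c * Real.sqrt t := by linarith
    _ = (a + B * Real.sqrt c) * Real.sqrt t := by ring


/-- **The crux reduced to its physical shape**: if at every admissible parameter point some bond `b_N` (with
`b_N + 1 < N` eventually) has `V_N(b_N,t) ≤ a√t + B·t/N` for all `t ≥ 1` (EW law + Kubo–KDN saturation with Ohmic
`N·G_N ≤ B/(2T²)`), then `SubdiffusiveBondHeat` holds (with `c = 1`, `A = a + B`).  The window `[1, cN²]` carries no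
difficulty of its own. [folklore] -/
theorem subdiffusiveBondHeat_of_diffusive_ohmic
    (h : ∀ ω₂ lam β γ : ℝ, 0 < ω₂ → 0 < lam → 0 < β → 0 < γ → ∀ T : ℝ, 0 < T →
      (let P := pinnedChain ω₂ lam β γ
       let C : ℕ → ℕ → ℝ → ℝ := fun N b s => if h : b < N then ∫ z, P.bondCurrent N ⟨b, h⟩ z *
         (∫ y, P.bondCurrent N ⟨b, h⟩ y ∂(P.transitionKernel N T T s.toNNReal z)) ∂(P.gibbsMeasure N T) else 0
       let V : ℕ → ℕ → ℝ → ℝ := fun N b t => 2 * ∫ s in (0 : ℝ)..t, (t - s) * C N b s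
       ∃ a B : ℝ, 0 ≤ B ∧ ∃ bN : ℕ → ℕ, ∃ N₁ : ℕ, (∀ N : ℕ, N₁ ≤ N → bN N + 1 < N) ∧
         ∀ N : ℕ, N₁ ≤ N → ∀ t : ℝ, 1 ≤ t → V N (bN N) t ≤ a * Real.sqrt t + B * t / N)) :
    SubdiffusiveBondHeat := by
  intro ω₂ lam β γ hω hl hβ hγ T hT P C V
  obtain ⟨a, B, hB, bN, N₁, hbN, hV⟩ := h ω₂ lam β γ hω hl hβ hγ T hT
  obtain ⟨N₀, hN₀⟩ := window_of_diffusive_ohmic V bN a B hB N₁ hbN hV 1 one_pos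
  exact ⟨a + B * Real.sqrt 1, 1, one_pos, N₀, fun N hN => hN₀ N hN⟩

end Summit.AtomisticToContinuum.FouriersLaw.Theorems.SubdiffusiveBondHeat.Negative.WindowThreshold

end
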